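import Summits.Ventures.QEC.Theorems.BB108DistanceCertificateLowerZ
import Summits.Ventures.QEC.Census.BB.BB108.BZAutInfoSetsZ1
import Summits.Ventures.QEC.Census.BB.BB108.BZAutBoundsZ
import Summits.Ventures.QEC.Census.BB.BB108.BZAutEnumZ01
import Summits.Ventures.QEC.Census.BB.BB108.BZAutEnumZ02
import Summits.Ventures.QEC.Census.BB.BB108.BZAutEnumZ03
import Summits.Ventures.QEC.Census.BB.BB108.BZAutEnumZ04
import Summits.Ventures.QEC.Census.BB.BB108.BZAutEnumZ05
import Summits.Ventures.QEC.Census.BB.BB108.BZAutEnumZ06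
import Summits.Ventures.QEC.Census.CertChunks
import Summits.Ventures.QEC.Theses.BB108DistanceCertificate
import HarnessLib

/-!
# Route BB108DistanceCertificate, item NoZLogicalBelowTen108 (stmt-Ventures-19828): every `Z`-type logical operator
# of `BB.bb108` (`QC(x³+y+y², y³+x+x²)` on `ℤ₉ × ℤ₆`, the `[[108,8,10]]` CLAIM) has Hamming weight `≥ 10` — KERNEL-std

The lower bound of the printed distance, CERTIFIED: the three representative Brouwer–Zimmermann blocks of the
kernel-A `bz_aut` certificate `e12036534ff94c78` (qec-search-10's 3-block translation-orbit cover on qec-search-1's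
conventions) are recombined from their KERNEL parts — information-set facts `autSysZ_b_i`
(`BZAutInfoSetsZ1`), enumeration verdicts `enumZ_b_i` (`BZAutEnumZ01…06`, `decide +kernel`, chunked first-row ranges
via qec-search-7's `CertScanSplit`), relative-rank bounds `autBoundZ_b` (`BZAutBoundsZ`) — by type-10's
`DistCert.bzZBlock_of_parts`, and fed to `ten_le_bb108_of_blocks` (`Theorems/BB108DistanceCertificateLowerZ.lean`:
type-10's `bzAut_lower_sound` + type-12's translation cover `coverAutOK` by `decide +kernel` + type-02's index
identities + type-05's flat transport). Every conjunct is `decide +kernel` or a structural proof: tier KERNEL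
(axioms ⊆ {propext, Classical.choice, Quot.sound}); no `native_decide` anywhere in the cone.
HONEST FRAMING: an independent certificate and its kernel replay; prior art for this code's distance in Lean:
Lean-QEC (arXiv:2605.16523) states `[[108,8,10]]` with sorried rank lemmas (cell FINDINGS / lit-3 PRIOR-ART table decide
any comparison sentence) — no «first» claim is made here.
-/

namespace Summit.Ventures.QEC.Census.BB108

open Matrix Literature.InformationTheory.QuantumCodes

/-- Block 0 of the `Z` side replays (parts ⇒ block). -/
theorem blockZ_0 : BB108.cert.bzZBlock BB108.bzAutData 0 = true :=
  BB108.cert.bzZBlock_of_parts BB108.bzAutData (b := 0) (m := 2) rfl rfl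
    (forall_lt_append (forall_lt_append forall_lt_zero (forall_lt_single 0 autSysZ_0_0)) (forall_lt_single 1 autSysZ_0_1))
    (forall_lt_append (forall_lt_append forall_lt_zero (forall_lt_single 0 enumZ_0_0)) (forall_lt_single 1 enumZ_0_1))
    autBoundZ_0

/-- Block 1 of the `Z` side replays. -/
theorem blockZ_1 : BB108.cert.bzZBlock BB108.bzAutData 1 = true :=
  BB108.cert.bzZBlock_of_parts BB108.bzAutData (b := 1) (m := 2) rfl rfl
    (forall_lt_append (forall_lt_append forall_lt_zero (forall_lt_single 0 autSysZ_1_0)) (forall_lt_single 1 autSysZ_1_1))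
    (forall_lt_append (forall_lt_append forall_lt_zero (forall_lt_single 0 enumZ_1_0)) (forall_lt_single 1 enumZ_1_1))
    autBoundZ_1

/-- Block 2 of the `Z` side replays. -/
theorem blockZ_2 : BB108.cert.bzZBlock BB108.bzAutData 2 = true :=
  BB108.cert.bzZBlock_of_parts BB108.bzAutData (b := 2) (m := 2) rfl rfl
    (forall_lt_append (forall_lt_append forall_lt_zero (forall_lt_single 0 autSysZ_2_0)) (forall_lt_single 1 autSysZ_2_1))
    (forall_lt_append (forall_lt_append forall_lt_zero (forall_lt_single 0 enumZ_2_0)) (forall_lt_single 1 enumZ_2_1))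
    autBoundZ_2

/-- All three representative `Z` blocks replay. -/
theorem blocksZ_ok : ∀ b : ℕ, b < BB108.bzAutData.sideZ.blocks.length → BB108.cert.bzZBlock BB108.bzAutData b = true :=
  forall_lt_append (forall_lt_append (forall_lt_append forall_lt_zero (forall_lt_single 0 blockZ_0))
    (forall_lt_single 1 blockZ_1)) (forall_lt_single 2 blockZ_2)

/-- **Item NoZLogicalBelowTen108, PROVED (KERNEL-std)**: every `Z`-type logical operator of `BB.bb108` has Hamming
weight `≥ 10`. -/
theorem noZLogicalBelowTen108_proof : Summit.Ventures.QEC.Theses.BB108DistanceCertificate.NoZLogicalBelowTen108 := by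
  unfold Summit.Ventures.QEC.Theses.BB108DistanceCertificate.NoZLogicalBelowTen108
  exact ten_le_bb108_of_blocks blocksZ_ok

end Summit.Ventures.QEC.Census.BB108
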